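import Summits.HodgeConjecture.HodgeConjecture.Theorems.F0P2oBlockFrame                  -- (BF) part 1 (this seat): `exists_blockFrame`, `diagonal_eq_finSum_one_two`
import Literature.NumberTheory.GelbartRogawski1991.LocalUnitaryBlockRestriction     -- ★ `BlockSum.inlLocal` ∕ `inrLocal` ∕ `inlLoc` ∕ `inrLoc`, `localPiEquiv_inlLoc`
import Literature.NumberTheory.GelbartRogawski1991.UnitaryDualPairThetaKernelCM       -- ★ `realDiagonal`, `realDiagonal_map`
import Literature.NumberTheory.Automorphic.LocalUnitaryGroupCongr                    -- ★ `cmDatumLocalCongr`, `coe_cmDatumLocalCongr_apply`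
import Literature.NumberTheory.Automorphic.UnitaryGroupBorelInduction                 -- ★ `cmBorelTriple`, `torusEntry`, `cmLocalForm_eq_over`, `conjLocal_conjLocal_cm`
import Literature.NumberTheory.Automorphic.UnitaryGroupBorelPair                      -- ★ `glDiagonal_mem_unitaryGroupOfForm_antidiagonal_iff`
import Literature.NumberTheory.Automorphic.UnitaryGroupNonsplitPlace                   -- ★ `LocalRing.isField_of_smul_eq`
import HarnessLib

/-!
# Crux `H413`, programme P2, N3 road, clause (a) — (BF) part 2: THE BLOCK-ADAPTED CONGRUENCE: a form congruence `T₀` reading `U(Φ₃)(L⁺_v)` in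
# `U(diag(t, a₁, a₂))(L⁺_v)` that sends `d(1, β, 1)` to `β ⊕ 1₂` and `d(γ, 1, γ̄⁻¹)` to `1 ⊕ (X · d₂(γ, γ̄⁻¹) · X⁻¹)`

Cell hodgecm-mathlib (D-0151), FLOOR 0, crux item H413 = stmt-HodgeConjecture-24833, programme P2; N3 road (#96 ★
`GelbartRogawski1991.thetaType_nonsplit_jacquetModule`, after ★ p836093 modulo its clause (a) alone), lead B-p18 (g29) dealing 2026-08-31T22:45:27Z (5)
«(BF) BLOCK-ADAPTED CONGRUENCE → A-p16 (g24)»; consumers F0P2-p01 (g8) ((N-iii) «ν = 1» read in the block model), B-p18 (g29) ((LS) local see-saw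
for `T = T₁ ⊕ᶠ T₂`), B-p08 (g24) ((FN)).  THEOREMS ONLY (no `def`, no instance, no notation, no named fact, no `sorry`); no `Cruxes/…/Lines` import; kernel
lane `--supports stmt-HodgeConjecture-24833 --as helper`.  HC_CM is proved only modulo the printed citations (2 remaining named inputs hLiu418, h413) until
rung 0 closes; this file is elementary hermitian linear algebra over the local ring `S = L ⊗ L⁺_v` and asserts nothing printed.

NOTATION.  `S := UnitaryGroup.LocalRing L v`, `σ := conjLocal L c̄ v`, `ι := algebraMap L S`; a block frame `dV' : Fin 3 → L` (real, non-zero entries) with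
LINE `dV' 0` (= `t`) and PLANE `fun k : Fin 2 => dV' k.succ` (= `(a₁, a₂)`); `H₂ := (diagonal (fun k => dV' k.succ)).map ι`, `H₃ := (diagonal dV').map ι`;
`Φ_N := (Matrix.of fun i j : Fin N => if i.val + j.val + 1 = N then (1 : L) else 0).map ι` (the `cmDatum` split form); `T₁ := realDiagonal L (fun _ : Fin 1 =>
dV' 0) _`, `T₂ := realDiagonal L (fun k : Fin 2 => dV' k.succ) _` (the (LS) block Gram data over `L⁺`).

* §1 `realDiagonal_eq_finSum` and `diagonal_eq_finSum_realDiagonal_map` — `diagonal dV' = (T₁ ⊕ᶠ T₂) ⊗ L`, the `hJ` hypothesis of ★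
  `BlockSum.inlLocal`∕`inrLocal`∕`inlLoc`∕`inrLoc` at the CM block frame (`Fin (1 + 2) = Fin 3` definitionally); the ring algebra (plane frame `X`,
  block-adapted frame `T₀ = (1 ⊕ X) · P₀₁`, the two conjugation laws in `GL₃`) is part 1 ★ `F0P2oBlockFrame.exists_blockFrame`.
* §2 **`exists_blockAdaptedCongr`** — the CM statement: `S = L ⊗ L⁺_v`, `a = ι ∘ dV'`, in the currencies of ★ `cmDatumLocalCongr L v T₀ ha₀ h₀ :
  U(Φ₃)(L⁺_v) ≃ₜ* U(diag dV')(L⁺_v)` (`a₀ = ι t`), ★ `cmBorelTriple`∕`torusEntry` and ★ `BlockSum.inlLocal`∕`inrLocal`: (i) a torus element `τ` with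
  `τ₀₀ = 1` goes to `inlLocal τ₁` for the rank-one unitary `τ₁ = (τ₁₁)`; (ii) a torus element `τ` with `τ₁₁ = 1` goes to `inrLocal (X τ₂ X⁻¹)` for the torus
  element `τ₂` of `U(Φ₂)(L⁺_v)` with the same first entry (its congruent by the plane frame `X`, ★ `cmDatumLocalCongr L v X ha₀ hX`).
* §3 `localPiEquiv_symm_eq_inlLoc`∕`_inrLoc` — transport of such identities to the factor forms `localPi` (★ `BlockSum.inlLoc`∕`inrLoc`, `localPiEquiv`).
* §4 `exists_hyperbolic_partner_of_nonsplit` — at a NON-SPLIT `v` (`S` a field), an isotropic `x ≠ 0` of the plane has a partner `xs` as in §2 (bridges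
  ★ `exists_rational_hyperbolic_frame`'s `LemD1.IsIsotropic` output to §2's input).

[Dieudonne1971GroupesClassiques, Chap. II §§4–5 (Witt, hyperbolic planes); Kudla1984, §1 (see-saw `U(V₁) × U(V₂) ⊂ U(V₁ ⊥ V₂)`); Rogawski1990, §1.10 p. 9
(the torus `d(α, β, ᾱ⁻¹)` of `U(Φ₃)`); PlatonovRapinchuk1994, §2.3 (form congruences).]
-/

set_option autoImplicit false
-- the mandated namespace has the single-problem summit's repeated segment (`HodgeConjecture.HodgeConjecture`)
set_option linter.dupNamespace false

noncomputable section

open scoped Matrix MatrixGroups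
open _root_.Matrix NumberField IsDedekindDomain
open Literature.NumberTheory.Automorphic Literature.NumberTheory.Automorphic.UnitaryGroup
open Literature.NumberTheory.GelbartRogawski1991.UnitaryDualPair
open Literature.NumberTheory.GelbartRogawski1991.UnitaryDualPair.LocalSplitting
open Summit.HodgeConjecture.HodgeConjecture.Cruxes.H413.F0P2oBlockFrame

namespace Summit.HodgeConjecture.HodgeConjecture.Cruxes.H413.F0P2oBlockAdaptedCongruence

/-! ## §1–§2 The CM statement: `U(Φ₃)(L⁺_v)` read in `U(diag dV')(L⁺_v)` through `T₀` -/

variable (L : Type) [Field L] [NumberField L] [IsCMField L]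

/-- **`diag(dV') = diag(dV'₀) ⊕ᶠ diag(dV'₁, dV'₂)` over `L⁺`** (★ `realDiagonal`): the CM Gram datum of a block frame IS the (LS) block sum
`T₁ ⊕ᶠ T₂` (`Fin 3 = Fin (1 + 2)` definitionally). [cite: Kudla1984, §1] -/
theorem realDiagonal_eq_finSum (dV' : Fin 3 → L) (hdV' : ∀ i, IsCMField.complexConj L (dV' i) = dV' i) :
    realDiagonal L dV' hdV' =
      UnitaryGroup.finSum 1 2 (realDiagonal L (fun _ : Fin 1 => dV' 0) (fun _ => hdV' 0))
        (realDiagonal L (fun k : Fin 2 => dV' k.succ) (fun k => hdV' k.succ)) := by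
  unfold realDiagonal
  exact diagonal_eq_finSum_one_two _

/-- **`diag(dV') = (T₁ ⊕ᶠ T₂) ⊗ L`** — the hypothesis `hJ` of ★ `BlockSum.inlLocal`∕`inrLocal`∕`inlLoc`∕`inrLoc` at the CM block frame (`T₁ = diag(dV'₀)`,
`T₂ = diag(dV'₁, dV'₂)` over `L⁺`, ★ `realDiagonal_map`). [cite: Kudla1984, §1] -/
theorem diagonal_eq_finSum_realDiagonal_map (dV' : Fin 3 → L) (hdV' : ∀ i, IsCMField.complexConj L (dV' i) = dV' i) :
    Matrix.diagonal dV' =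
      (UnitaryGroup.finSum 1 2 (realDiagonal L (fun _ : Fin 1 => dV' 0) (fun _ => hdV' 0))
        (realDiagonal L (fun k : Fin 2 => dV' k.succ) (fun k => hdV' k.succ))).map (algebraMap (↥(maximalRealSubfield L)) L) := by
  rw [← realDiagonal_eq_finSum, realDiagonal_map]

set_option maxHeartbeats 4000000 in
/-- **(BF) THE BLOCK-ADAPTED CONGRUENCE.**  For a block frame `dV'` (line `dV' 0`, plane `(dV' 1, dV' 2)`, real non-zero entries) and a hyperbolic
pair `(x, xs)` of the plane `H₂ = diag(dV' 1, dV' 2) ⊗ 1` over `S = L ⊗ L⁺_v` scaled to `h₂(x, xs) = ι (dV' 0)`: the plane frame `X = (x ∣ xs)`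
(`ᵗ(σX) H₂ X = ι t • Φ₂`), the frame `T₀ = (0,x) ∣ (1,0,0) ∣ (0,xs)` (`ᵗ(σT₀) H₃ T₀ = ι t • Φ₃`, so `a₀ = ι t` in ★ `cmDatumLocalCongr L v T₀ ha₀ h₀ :
U(Φ₃)(L⁺_v) ≃ₜ* U(diag dV')(L⁺_v)`, `g ↦ T₀ g T₀⁻¹`), and the two conjugation laws in ★ `torusEntry`∕`BlockSum` currency:
(i) a torus element `τ` of `U(Φ₃)(L⁺_v)` with `τ₀₀ = 1` (`τ = d(1, β, 1)`) goes to `β ⊕ 1₂ = BlockSum.inlLocal … τ₁` for every rank-one unitary `τ₁`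
with entry `β = τ₁₁`; (ii) a torus element `τ` with `τ₁₁ = 1` (`τ = d(γ, 1, γ̄⁻¹)`) goes to `1 ⊕ (X · τ₂ · X⁻¹) = BlockSum.inrLocal … (cmDatumLocalCongr L
v X ha₀ hX τ₂)` for every torus element `τ₂` of `U(Φ₂)(L⁺_v)` with first entry `γ = τ₀₀`.
[cite: Dieudonne1971GroupesClassiques, Chap. II §5] [cite: Kudla1984, §1] [cite: Rogawski1990, §1.10 p. 9] [cite: PlatonovRapinchuk1994, §2.3] -/
theorem exists_blockAdaptedCongr (v : HeightOneSpectrum (𝓞 ↥(maximalRealSubfield L)))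
    (dV' : Fin 3 → L) (hdV' : ∀ i, IsCMField.complexConj L (dV' i) = dV' i) (hdV'0 : ∀ i, dV' i ≠ 0)
    (x xs : Fin 2 → UnitaryGroup.LocalRing L v)
    (hxx : hermForm (conjLocal L (IsCMField.complexConj L) v)
      ((Matrix.diagonal fun k : Fin 2 => dV' k.succ).map (algebraMap L (UnitaryGroup.LocalRing L v))) x x = 0)
    (hss : hermForm (conjLocal L (IsCMField.complexConj L) v)
      ((Matrix.diagonal fun k : Fin 2 => dV' k.succ).map (algebraMap L (UnitaryGroup.LocalRing L v))) xs xs = 0)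
    (hxs : hermForm (conjLocal L (IsCMField.complexConj L) v)
      ((Matrix.diagonal fun k : Fin 2 => dV' k.succ).map (algebraMap L (UnitaryGroup.LocalRing L v))) x xs =
        algebraMap L (UnitaryGroup.LocalRing L v) (dV' 0)) :
    ∃ (X : GL (Fin 2) (UnitaryGroup.LocalRing L v)) (T₀ : GL (Fin 3) (UnitaryGroup.LocalRing L v))
      (hX : formCongr (conjLocal L (IsCMField.complexConj L) v) X
          ((Matrix.diagonal fun k : Fin 2 => dV' k.succ).map (algebraMap L (UnitaryGroup.LocalRing L v))) =
        algebraMap L (UnitaryGroup.LocalRing L v) (dV' 0) •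
          (Matrix.of fun i j : Fin 2 => if i.val + j.val + 1 = 2 then (1 : L) else 0).map (algebraMap L (UnitaryGroup.LocalRing L v)))
      (h₀ : formCongr (conjLocal L (IsCMField.complexConj L) v) T₀
          ((Matrix.diagonal dV').map (algebraMap L (UnitaryGroup.LocalRing L v))) =
        algebraMap L (UnitaryGroup.LocalRing L v) (dV' 0) •
          (Matrix.of fun i j : Fin 3 => if i.val + j.val + 1 = 3 then (1 : L) else 0).map (algebraMap L (UnitaryGroup.LocalRing L v))),
      X.val = !![x 0, xs 0; x 1, xs 1] ∧
      T₀.val = !![0, 1, 0; x 0, 0, xs 0; x 1, 0, xs 1] ∧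
      (∀ (τ : ↥(cmBorelTriple L 3 v).M)
          (τ₁ : ↥(UnitaryGroup.«local» L (IsCMField.complexConj L) 1 (Matrix.diagonal fun _ : Fin 1 => dV' 0) v)),
        torusEntry (conjLocal L (IsCMField.complexConj L) v) (cmLocalForm L 3 v) 0 τ = 1 →
        (τ₁ : GL (Fin 1) (UnitaryGroup.LocalRing L v)).val 0 0 =
          ((torusEntry (conjLocal L (IsCMField.complexConj L) v) (cmLocalForm L 3 v) 1 τ : (UnitaryGroup.LocalRing L v)ˣ) :
            UnitaryGroup.LocalRing L v) →
        cmDatumLocalCongr L v T₀ ((hdV'0 0).isUnit.map (algebraMap L (UnitaryGroup.LocalRing L v))) h₀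
            (τ : ↥(unitaryGroupOfForm (conjLocal L (IsCMField.complexConj L) v) (cmLocalForm L 3 v))) =
          BlockSum.inlLocal (↥(maximalRealSubfield L)) L (IsCMField.complexConj L) v 1 2
            (realDiagonal_map L (fun _ : Fin 1 => dV' 0) (fun _ => hdV' 0)).symm (diagonal_eq_finSum_realDiagonal_map L dV' hdV') τ₁) ∧
      (∀ (τ : ↥(cmBorelTriple L 3 v).M) (τ₂ : ↥(cmBorelTriple L 2 v).M),
        torusEntry (conjLocal L (IsCMField.complexConj L) v) (cmLocalForm L 3 v) 1 τ = 1 →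
        torusEntry (conjLocal L (IsCMField.complexConj L) v) (cmLocalForm L 2 v) 0 τ₂ =
          torusEntry (conjLocal L (IsCMField.complexConj L) v) (cmLocalForm L 3 v) 0 τ →
        cmDatumLocalCongr L v T₀ ((hdV'0 0).isUnit.map (algebraMap L (UnitaryGroup.LocalRing L v))) h₀
            (τ : ↥(unitaryGroupOfForm (conjLocal L (IsCMField.complexConj L) v) (cmLocalForm L 3 v))) =
          BlockSum.inrLocal (↥(maximalRealSubfield L)) L (IsCMField.complexConj L) v 1 2
            (realDiagonal_map L (fun k : Fin 2 => dV' k.succ) (fun k => hdV' k.succ)).symm (diagonal_eq_finSum_realDiagonal_map L dV' hdV')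
            (cmDatumLocalCongr L v X ((hdV'0 0).isUnit.map (algebraMap L (UnitaryGroup.LocalRing L v))) hX
              (τ₂ : ↥(unitaryGroupOfForm (conjLocal L (IsCMField.complexConj L) v) (cmLocalForm L 2 v))))) := by
  classical
  set σ := conjLocal L (IsCMField.complexConj L) v with hσdef
  set ι := algebraMap L (UnitaryGroup.LocalRing L v) with hιdef
  have hσσ : ∀ z, σ (σ z) = z := conjLocal_conjLocal_cm L v
  have hσι : ∀ e : L, σ (ι e) = ι (IsCMField.complexConj L e) := fun e => conjLocal_algebraMap (IsCMField.complexConj L) v e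
  have ha : ∀ i, σ ((fun i => ι (dV' i)) i) = (fun i => ι (dV' i)) i := fun i => by
    change σ (ι (dV' i)) = ι (dV' i); rw [hσι, hdV' i]
  have hιu : IsUnit ((fun i => ι (dV' i)) 0) := (hdV'0 0).isUnit.map ι
  -- the explicit forms of the tree's `map`ped matrices
  have hH₂e : (Matrix.diagonal fun k : Fin 2 => dV' k.succ).map ι = Matrix.diagonal fun k : Fin 2 => (fun i => ι (dV' i)) k.succ := by
    rw [Matrix.diagonal_map (map_zero ι)]
  have hH₃e : (Matrix.diagonal dV').map ι = Matrix.diagonal fun i => ι (dV' i) := by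
    rw [Matrix.diagonal_map (map_zero ι)]
  have hΦ₂e : (Matrix.of fun i j : Fin 2 => if i.val + j.val + 1 = 2 then (1 : L) else 0).map ι = !![(0 : UnitaryGroup.LocalRing L v), 1; 1, 0] := by
    ext i j : 1; fin_cases i <;> fin_cases j <;> simp
  have hΦ₃e : (Matrix.of fun i j : Fin 3 => if i.val + j.val + 1 = 3 then (1 : L) else 0).map ι =
      !![(0 : UnitaryGroup.LocalRing L v), 0, 1; 0, 1, 0; 1, 0, 0] := by
    ext i j : 1; fin_cases i <;> fin_cases j <;> simp
  rw [hH₂e] at hxx hss hxs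
  obtain ⟨X, T₀, hXc, hT₀c, hX', h₀', hi, hii⟩ := exists_blockFrame σ hσσ (fun i => ι (dV' i)) ha hιu x xs hxx hss hxs
  have hX : formCongr σ X ((Matrix.diagonal fun k : Fin 2 => dV' k.succ).map ι) =
      ι (dV' 0) • (Matrix.of fun i j : Fin 2 => if i.val + j.val + 1 = 2 then (1 : L) else 0).map ι := by
    rw [hH₂e, hΦ₂e]; exact hX'
  have h₀ : formCongr σ T₀ ((Matrix.diagonal dV').map ι) =
      ι (dV' 0) • (Matrix.of fun i j : Fin 3 => if i.val + j.val + 1 = 3 then (1 : L) else 0).map ι := by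
    rw [hH₃e, hΦ₃e]; exact h₀'
  -- the unitarity relations on the torus of `U(Φ_N)(L⁺_v)`
  have hrel : ∀ (N : ℕ) (τ : ↥(cmBorelTriple L N v).M) (d : Fin N → (UnitaryGroup.LocalRing L v)ˣ),
      glDiagonal N (UnitaryGroup.LocalRing L v) d =
          ((τ : ↥(unitaryGroupOfForm σ (cmLocalForm L N v))) : GL (Fin N) (UnitaryGroup.LocalRing L v)) →
        ∀ i : Fin N, σ (d (Fin.rev i) : UnitaryGroup.LocalRing L v) * (d i : UnitaryGroup.LocalRing L v) = 1 := by
    intro N τ d hd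
    have hmem : glDiagonal N (UnitaryGroup.LocalRing L v) d ∈
        unitaryGroupOfForm σ ((StdForm.antidiagonal N).over (UnitaryGroup.LocalRing L v)) := by
      rw [hd, ← cmLocalForm_eq_over L N v]; exact (τ : ↥(unitaryGroupOfForm σ (cmLocalForm L N v))).2
    exact (glDiagonal_mem_unitaryGroupOfForm_antidiagonal_iff σ N d).1 hmem
  refine ⟨X, T₀, hX, h₀, hXc, hT₀c, ?_, ?_⟩
  · /- (i) `T₀ · d(1, β, 1) · T₀⁻¹ = β ⊕ 1₂` -/
    intro τ τ₁ hτ0 hτ₁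
    obtain ⟨d, hd⟩ := (mem_torusU_iff _).1 τ.2
    have hd0 : d 0 = 1 := by rw [← torusEntry_eq_of_glDiagonal_eq σ (cmLocalForm L 3 v) 0 τ d hd]; exact hτ0
    have hd2 : d 2 = 1 := by
      have h := hrel 3 τ d hd 2
      have hrev : Fin.rev (2 : Fin 3) = 0 := by decide
      rw [hrev, hd0, Units.val_one, map_one, one_mul] at h
      exact Units.ext h
    have hτ₁e : (τ₁ : GL (Fin 1) (UnitaryGroup.LocalRing L v)) = glDiagonal 1 (UnitaryGroup.LocalRing L v) (fun _ : Fin 1 => d 1) := by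
      apply Units.ext
      rw [coe_glDiagonal]
      ext i j : 1
      have hi : i = 0 := Subsingleton.elim _ _
      have hj : j = 0 := Subsingleton.elim _ _
      subst hi hj
      rw [Matrix.diagonal_apply_eq, ← torusEntry_eq_of_glDiagonal_eq σ (cmLocalForm L 3 v) 1 τ d hd]
      exact hτ₁
    apply Subtype.ext
    change T₀ * ((τ : ↥(unitaryGroupOfForm σ (cmLocalForm L 3 v))) : GL (Fin 3) (UnitaryGroup.LocalRing L v)) * T₀⁻¹ =
      UnitaryGroup.reindexGL finSumFinEquiv
        (UnitaryGroup.blockDiagGL ((τ₁ : GL (Fin 1) (UnitaryGroup.LocalRing L v)), (1 : GL (Fin 2) (UnitaryGroup.LocalRing L v))))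
    rw [← hd, hτ₁e]
    exact hi d hd0 hd2
  · /- (ii) `T₀ · d(γ, 1, γ̄⁻¹) · T₀⁻¹ = 1 ⊕ (X · d₂(γ, γ̄⁻¹) · X⁻¹)` -/
    intro τ τ₂ hτ1 hτ₂0
    obtain ⟨d, hd⟩ := (mem_torusU_iff _).1 τ.2
    obtain ⟨e, he⟩ := (mem_torusU_iff _).1 τ₂.2
    have hd1 : d 1 = 1 := by rw [← torusEntry_eq_of_glDiagonal_eq σ (cmLocalForm L 3 v) 1 τ d hd]; exact hτ1
    have he0 : e 0 = d 0 := by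
      rw [← torusEntry_eq_of_glDiagonal_eq σ (cmLocalForm L 2 v) 0 τ₂ e he,
        ← torusEntry_eq_of_glDiagonal_eq σ (cmLocalForm L 3 v) 0 τ d hd]
      exact hτ₂0
    have he1 : e 1 = d 2 := by
      have h3 := hrel 3 τ d hd 2
      have h2 := hrel 2 τ₂ e he 1
      have hrev3 : Fin.rev (2 : Fin 3) = 0 := by decide
      have hrev2 : Fin.rev (1 : Fin 2) = 0 := by decide
      rw [hrev3] at h3
      rw [hrev2, he0] at h2
      apply Units.ext
      calc (e 1 : UnitaryGroup.LocalRing L v)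
          = (e 1 : UnitaryGroup.LocalRing L v) * (σ (d 0 : UnitaryGroup.LocalRing L v) * (d 2 : UnitaryGroup.LocalRing L v)) := by
            rw [h3, mul_one]
        _ = σ (d 0 : UnitaryGroup.LocalRing L v) * (e 1 : UnitaryGroup.LocalRing L v) * (d 2 : UnitaryGroup.LocalRing L v) := by ring
        _ = (d 2 : UnitaryGroup.LocalRing L v) := by rw [h2, one_mul]
    apply Subtype.ext
    change T₀ * ((τ : ↥(unitaryGroupOfForm σ (cmLocalForm L 3 v))) : GL (Fin 3) (UnitaryGroup.LocalRing L v)) * T₀⁻¹ =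
      UnitaryGroup.reindexGL finSumFinEquiv (UnitaryGroup.blockDiagGL ((1 : GL (Fin 1) (UnitaryGroup.LocalRing L v)),
        X * ((τ₂ : ↥(unitaryGroupOfForm σ (cmLocalForm L 2 v))) : GL (Fin 2) (UnitaryGroup.LocalRing L v)) * X⁻¹))
    rw [← hd, ← he]
    exact hii d e hd1 he0 he1

/-! ## §3 The same laws on the factor forms `localPi` (through ★ `localPiEquiv`) -/

section Transport

variable {L}
variable {v : HeightOneSpectrum (𝓞 ↥(maximalRealSubfield L))} {T₁ : Matrix (Fin 1) (Fin 1) ↥(maximalRealSubfield L)}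
  {T₂ : Matrix (Fin 2) (Fin 2) ↥(maximalRealSubfield L)}
  {J₁ : Matrix (Fin 1) (Fin 1) L} (hJ₁ : J₁ = T₁.map (algebraMap (↥(maximalRealSubfield L)) L))
  {J₂ : Matrix (Fin 2) (Fin 2) L} (hJ₂ : J₂ = T₂.map (algebraMap (↥(maximalRealSubfield L)) L))
  {J : Matrix (Fin (1 + 2)) (Fin (1 + 2)) L} (hJ : J = (UnitaryGroup.finSum 1 2 T₁ T₂).map (algebraMap (↥(maximalRealSubfield L)) L))

/-- **transport to `localPi`, left block**: an identity `g = inlLocal g₁` in the matrix-form groups reads `localPiEquiv⁻¹ g = inlLoc (localPiEquiv⁻¹ g₁)` on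
the factor forms (★ `localPiEquiv_inlLoc`). [cite: Kudla1984, §1] -/
theorem localPiEquiv_symm_eq_inlLoc (g : ↥(UnitaryGroup.«local» L (IsCMField.complexConj L) (1 + 2) J v))
    (g₁ : ↥(UnitaryGroup.«local» L (IsCMField.complexConj L) 1 J₁ v))
    (h : g = BlockSum.inlLocal (↥(maximalRealSubfield L)) L (IsCMField.complexConj L) v 1 2 hJ₁ hJ g₁) :
    (UnitaryGroup.localPiEquiv L (IsCMField.complexConj L) (1 + 2) J v).symm g =
      BlockSum.inlLoc (↥(maximalRealSubfield L)) L (IsCMField.complexConj L) v 1 2 hJ₁ hJ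
        ((UnitaryGroup.localPiEquiv L (IsCMField.complexConj L) 1 J₁ v).symm g₁) := by
  apply (UnitaryGroup.localPiEquiv L (IsCMField.complexConj L) (1 + 2) J v).injective
  rw [ContinuousMulEquiv.apply_symm_apply, BlockSum.localPiEquiv_inlLoc, ContinuousMulEquiv.apply_symm_apply, h]

/-- **transport to `localPi`, right block**: an identity `g = inrLocal g₂` in the matrix-form groups reads `localPiEquiv⁻¹ g = inrLoc (localPiEquiv⁻¹ g₂)`
on the factor forms (★ `localPiEquiv_inrLoc`). [cite: Kudla1984, §1] -/
theorem localPiEquiv_symm_eq_inrLoc (g : ↥(UnitaryGroup.«local» L (IsCMField.complexConj L) (1 + 2) J v))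
    (g₂ : ↥(UnitaryGroup.«local» L (IsCMField.complexConj L) 2 J₂ v))
    (h : g = BlockSum.inrLocal (↥(maximalRealSubfield L)) L (IsCMField.complexConj L) v 1 2 hJ₂ hJ g₂) :
    (UnitaryGroup.localPiEquiv L (IsCMField.complexConj L) (1 + 2) J v).symm g =
      BlockSum.inrLoc (↥(maximalRealSubfield L)) L (IsCMField.complexConj L) v 1 2 hJ₂ hJ
        ((UnitaryGroup.localPiEquiv L (IsCMField.complexConj L) 2 J₂ v).symm g₂) := by
  apply (UnitaryGroup.localPiEquiv L (IsCMField.complexConj L) (1 + 2) J v).injective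
  rw [ContinuousMulEquiv.apply_symm_apply, BlockSum.localPiEquiv_inrLoc, ContinuousMulEquiv.apply_symm_apply, h]

end Transport

/-! ## §4 The hyperbolic partner at a non-split place -/

set_option maxHeartbeats 2000000 in
/-- **a hyperbolic partner at a non-split place**: at a finite place `v` of `L⁺` NON-SPLIT in `L` (`S = L ⊗ L⁺_v` is a field, ★
`LocalRing.isField_of_smul_eq`), an isotropic vector `x ≠ 0` of the plane `H₂ = diag(a₁, a₂) ⊗ 1` (`aₖ` real and non-zero) has, for every real `t`,
a partner `xs` with `h₂(xs, xs) = 0` and `h₂(x, xs) = ι t` (Witt: `xs = ι t · (y₁ − ½ h₂(y₁,y₁) x)` with `h₂(x, y₁) = 1`).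
[cite: Dieudonne1971GroupesClassiques, Chap. II §4] -/
theorem exists_hyperbolic_partner_of_nonsplit (v : HeightOneSpectrum (𝓞 ↥(maximalRealSubfield L)))
    (hv : ∀ w : PlacesOver L v, IsCMField.complexConj L • w.1 = w.1)
    (a : Fin 2 → L) (ha : ∀ k, IsCMField.complexConj L (a k) = a k) (ha0 : ∀ k, a k ≠ 0) (t : L)
    (x : Fin 2 → UnitaryGroup.LocalRing L v) (hx0 : x ≠ 0)
    (hxx : hermForm (conjLocal L (IsCMField.complexConj L) v)
      ((Matrix.diagonal a).map (algebraMap L (UnitaryGroup.LocalRing L v))) x x = 0) :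
    ∃ xs : Fin 2 → UnitaryGroup.LocalRing L v,
      hermForm (conjLocal L (IsCMField.complexConj L) v)
          ((Matrix.diagonal a).map (algebraMap L (UnitaryGroup.LocalRing L v))) xs xs = 0 ∧
        hermForm (conjLocal L (IsCMField.complexConj L) v)
          ((Matrix.diagonal a).map (algebraMap L (UnitaryGroup.LocalRing L v))) x xs =
            algebraMap L (UnitaryGroup.LocalRing L v) t := by
  classical
  set σ := conjLocal L (IsCMField.complexConj L) v with hσdef
  set ι := algebraMap L (UnitaryGroup.LocalRing L v) with hιdef
  set H : Matrix (Fin 2) (Fin 2) (UnitaryGroup.LocalRing L v) := (Matrix.diagonal a).map ι with hHdef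
  have hσσ : ∀ z, σ (σ z) = z := conjLocal_conjLocal_cm L v
  have hσι : ∀ e : L, σ (ι e) = ι (IsCMField.complexConj L e) := fun e => conjLocal_algebraMap (IsCMField.complexConj L) v e
  -- at a non-split place an element of `S = L ⊗ L⁺_v` is read at the unique `w ∣ v`
  obtain ⟨w⟩ := PlacesOver.nonempty L v
  have heq : ∀ u u' : UnitaryGroup.LocalRing L v, u = u' ↔ u w = u' w :=
    fun u u' => LocalRing.eq_iff_apply_eq (IsCMField.complexConj L) (IsCMField.complexConj_ne_one L) w (hv w) u u'
  have hne : ∀ u : UnitaryGroup.LocalRing L v, u ≠ 0 ↔ u w ≠ 0 := fun u => (heq u 0).not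
  have hmulne : ∀ u u' : UnitaryGroup.LocalRing L v, u ≠ 0 → u' ≠ 0 → u * u' ≠ 0 := fun u u' hu hu' =>
    (hne _).2 (by rw [Pi.mul_apply]; exact mul_ne_zero ((hne u).1 hu) ((hne u').1 hu'))
  have hinv : ∀ u : UnitaryGroup.LocalRing L v, u ≠ 0 → u⁻¹ * u = 1 := fun u hu =>
    (heq _ _).2 (by rw [Pi.mul_apply, Pi.inv_apply, Pi.one_apply]; exact inv_mul_cancel₀ ((hne u).1 hu))
  have hσne : ∀ u : UnitaryGroup.LocalRing L v, u ≠ 0 → σ u ≠ 0 := fun u hu h =>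
    hu (by rw [← hσσ u, h, map_zero])
  have hHe : H = Matrix.diagonal fun k => ι (a k) := by rw [hHdef, Matrix.diagonal_map (map_zero ι)]
  have hHh : (H.map σ)ᵀ = H := by
    rw [hHe, Matrix.diagonal_map (map_zero σ), Matrix.diagonal_transpose]
    congr 1; funext k; rw [hσι, ha k]
  have hpair : ∀ u u' : Fin 2 → UnitaryGroup.LocalRing L v, hermForm σ H u u' = σ (u 0) * (ι (a 0) * u' 0) + σ (u 1) * (ι (a 1) * u' 1) := by
    intro u u'
    simp only [hHe, hermForm_apply, dotProduct, Fin.sum_univ_two, Matrix.mulVec_diagonal, Function.comp_apply]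
  -- a coordinate vector `y = e_k` with `l := h(x, y) ≠ 0`
  obtain ⟨k, hk⟩ : ∃ k, x k ≠ 0 := by
    obtain ⟨k, hk⟩ := Function.ne_iff.1 hx0
    exact ⟨k, hk⟩
  have hxk : hermForm σ H x (Pi.single k 1) = σ (x k) * ι (a k) := by
    rw [hpair]
    fin_cases k
    · simp
    · simp
  have hl0 : hermForm σ H x (Pi.single k 1) ≠ 0 := by
    rw [hxk]
    exact hmulne _ _ (hσne _ hk) ((map_ne_zero ι).2 (ha0 k))
  -- normalise: `h(x, y₁) = 1`
  obtain ⟨y₁, hy₁⟩ : ∃ y₁ : Fin 2 → UnitaryGroup.LocalRing L v, y₁ = (hermForm σ H x (Pi.single k 1))⁻¹ • Pi.single k 1 :=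
    ⟨_, rfl⟩
  have hxy₁ : hermForm σ H x y₁ = 1 := by rw [hy₁, hermForm_smul_right, hinv _ hl0]
  have hy₁x : hermForm σ H y₁ x = 1 := by rw [← conj_hermForm σ H hσσ hHh x y₁, hxy₁, map_one]
  -- `c = h(y₁, y₁)` is real; `m = c · ι(½)` is real with `m + m = c`
  obtain ⟨c, hc⟩ : ∃ c : UnitaryGroup.LocalRing L v, c = hermForm σ H y₁ y₁ := ⟨_, rfl⟩
  have hcσ : σ c = c := by rw [hc]; exact conj_hermForm σ H hσσ hHh y₁ y₁
  obtain ⟨m, hm⟩ : ∃ m : UnitaryGroup.LocalRing L v, m = c * ι (2⁻¹ : L) := ⟨_, rfl⟩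
  have hmσ : σ m = m := by
    rw [hm, map_mul, hcσ, hσι, map_inv₀, map_ofNat]
  have hmm : m + m = c := by
    rw [hm, ← mul_add, ← map_add, show (2⁻¹ : L) + 2⁻¹ = 1 by norm_num, map_one, mul_one]
  -- the partner `xs₀ = y₁ − m x`: `h(x, xs₀) = 1`, `h(xs₀, xs₀) = 0`
  obtain ⟨xs₀, hxs₀⟩ : ∃ xs₀ : Fin 2 → UnitaryGroup.LocalRing L v, xs₀ = y₁ - m • x := ⟨_, rfl⟩
  have hx_xs₀ : hermForm σ H x xs₀ = 1 := by
    rw [hxs₀, hermForm_sub_right, hermForm_smul_right, hxy₁, hxx, mul_zero, sub_zero]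
  have hxs₀_xs₀ : hermForm σ H xs₀ xs₀ = 0 := by
    rw [hxs₀]
    simp only [hermForm_sub_right, hermForm_sub_left, hermForm_smul_right, hermForm_smul_left_eq, hxy₁, hy₁x, hxx, hmσ,
      ← hc]
    linear_combination (-1 : UnitaryGroup.LocalRing L v) * hmm
  -- scale by the real `ι t`
  refine ⟨ι t • xs₀, ?_, ?_⟩
  · rw [hermForm_smul_right, hermForm_smul_left_eq, hxs₀_xs₀, mul_zero, mul_zero]
  · rw [hermForm_smul_right, hx_xs₀, mul_one]

end Summit.HodgeConjecture.HodgeConjecture.Cruxes.H413.F0P2oBlockAdaptedCongruence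

end
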